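import Summits.CriticalPhenomena.PercolationContinuityZ3.Theorems.PercNearOneGluingNoHeavyLowerTailKNQuestion7AllRelays
import Summits.CriticalPhenomena.PercolationContinuityZ3.Theorems.PercNearOneGluingNoHeavyLowerTailCILReduction
import Summits.CriticalPhenomena.PercolationContinuityZ3.Theses.PercNearOneGluingNoHeavy
import HarnessLib

/-!
# The CUMULATIVE ISOLATION LEMMA — every level, every relay set, every weight vector

Support file (`--supports stmt-CriticalPhenomena-4575`), prover `prim-ineq-gen-6` (gen 10).  No definitions, no named
facts, no sorries; standard axioms.

For bond percolation `μ = prodBernoulli w` on `Fin n`, a relay set `A ≠ ∅`, an observer `o` and a vertex `v` write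
`π(v) = C(v) ∩ A` for the set of relays in the open cluster of `v` and `N = |π(o)|`.  The CUMULATIVE ISOLATION LEMMA at
level `j` — the "maximum principle for small relay blocks" of the one-cut line of the crux `NoHeavyLowerTail` —

  `CIL_j :  P(1 ≤ N ≤ j) ≤ max_{a ∈ A} P(|π(a)| ≤ j)`

was that line's registered stub `stub_cumulativeIsolation` (consumed verbatim by
`Theorems.noHeavyLowerTail_of_stub_cumulativeIsolation` and `Theorems.additiveGluing_of_stub_cumulativeIsolation`); the
tree held it at level `1` (Kozma–Nitzan's Lemma 2, `Theorems.cumulativeIsolation_level_one`), for `|A| ≤ 4`, for `≤ 4`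
blobs, at levels `≥ |A| − 2`, and on many structural classes, but not in general.

THIS FILE PROVES IT IN GENERAL, in the sharper pre-FKG form with the maximiser NAMED: for every `c ∈ A` maximising
`P(|π(c)| ≤ j)` over `A`,

  `P(1 ≤ N ≤ j) ≤ P(o ↔ A, |π(c)| ≤ j)`                                    (`CIL.lowerTail_le_inter`),

which is the one-cut line's registered ATTACHED-CHAMPION stub `stub_attachedChampion` (lead nh-lead-4575: "XZ, sharper than
CIL, drops the Harris gap; 0 violations in ~1.3e4 exact cases") — discharged here verbatim as `CIL.stub_attachedChampion`.

Proof: Kozma–Nitzan's Conjecture 4 in designated form for every weight vector (`Q7Psi.kn_conj4_designated`: the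
conditioned slack hierarchy `CSH.cshAll` through `PreFKGSurplus.kn_conj4_designated_holds`, closed over degenerate weights
by `Q7Psi.gpsi_of_nondegenerate`) applied to the monotone cluster property `F(S) = 1{|S ∩ A| > j}`: its least-mean relay is
`c`, and `∫_{o↔A} F(C c) ≤ ∫_{o↔A} F(C o)` reads `P(o ↔ A, |π(c)| > j) ≤ P(N > j)`; subtract both sides from `P(o ↔ A)`
(`{o ↔ A} = {N ≥ 1} ⊇ {N > j}`).  (The quantitative version with the detachment terms `Σ φ_a (P(|π(a)| > j) − P(|π(c)| > j))`
is `PreFKGSurplus.quantitativeCIL_holds` / `quantitative_kn_conj4`, FINDING-G9 §5 of the cell memo.)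

Corollaries: the registered stub signature verbatim (`CIL.stub_cumulativeIsolation`, discharging that stub by name and signature), hence a second CSH-based derivation of
the crux through the one-cut line's landed reduction — `CIL.noHeavyLowerTail_of_cil` (stmt-4575, route
`PercNearOneGluingNoHeavy` spelling; `additiveGluing_of_stub_cumulativeIsolation CIL.stub_cumulativeIsolation` likewise re-derives
stmt-4576, already a tree theorem `AdditiveGluing_proof`, and is not restated here).
[cite: KozmaNitzan2024, Lemma 2 (p. 6), Conjecture 4 (p. 32), Conjecture 3 (p. 15)]
-/

noncomputable section

namespace Summit.CriticalPhenomena.PercolationContinuityZ3.Theorems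

open MeasureTheory Set Literature.Probability.LatticeModels Literature.Probability.Percolation
open scoped Classical

namespace CIL

variable {n : ℕ}

/-- The block-size threshold functional `S ↦ 1{j < |S ∩ A|}` is monotone. [folklore] -/
theorem threshold_monotone (A : Finset (Fin n)) (j : ℕ) :
    ∀ S T : Set (Fin n), S ⊆ T →
      (fun S : Set (Fin n) => if j < (A.filter fun y => y ∈ S).card then (1 : ℝ) else 0) S ≤
        (fun S : Set (Fin n) => if j < (A.filter fun y => y ∈ S).card then (1 : ℝ) else 0) T := by
  intro S T hST
  have hsub : (A.filter fun y => y ∈ S) ⊆ (A.filter fun y => y ∈ T) :=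
    Finset.monotone_filter_right A fun _ _ hy => hST hy
  have hcard := Finset.card_le_card hsub
  by_cases hS : j < (A.filter fun y => y ∈ S).card
  · have hT : j < (A.filter fun y => y ∈ T).card := lt_of_lt_of_le hS hcard
    simp only [hS, hT, if_true, le_refl]
  · by_cases hT : j < (A.filter fun y => y ∈ T).card
    · simp only [hS, hT, if_true, if_false, zero_le_one]
    · simp only [hS, hT, if_false, le_refl]

/-- The relays in the cluster of `x`, counted through `openCluster` or through `openConn`, are the same finset.
[folklore] -/
theorem filter_mem_openCluster (A : Finset (Fin n)) (ω : BondConfig (Fin n)) (x : Fin n) :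
    (A.filter fun y => y ∈ openCluster ω x) = A.filter fun y => ω ∈ openConn x y :=
  Finset.filter_congr fun _ _ => Iff.rfl

/-- `E[1{j < |C(x) ∩ A|}; E] = μ({j < |π(x)|} ∩ E)`. [folklore] -/
theorem setIntegral_threshold (w : Sym2 (Fin n) → unitInterval) (A : Finset (Fin n)) (x : Fin n) (j : ℕ)
    (E : Set (BondConfig (Fin n))) :
    ∫ ω in E, (fun S : Set (Fin n) => if j < (A.filter fun y => y ∈ S).card then (1 : ℝ) else 0) (openCluster ω x)
        ∂(prodBernoulli w) =
      (prodBernoulli w).real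
        ({ω : BondConfig (Fin n) | j < (A.filter fun y => ω ∈ openConn x y).card} ∩ E) := by
  have e : (fun ω : BondConfig (Fin n) =>
      (fun S : Set (Fin n) => if j < (A.filter fun y => y ∈ S).card then (1 : ℝ) else 0) (openCluster ω x)) =
      {ω : BondConfig (Fin n) | j < (A.filter fun y => ω ∈ openConn x y).card}.indicator 1 := by
    funext ω
    simp only [filter_mem_openCluster]
    by_cases hω : ω ∈ {ω : BondConfig (Fin n) | j < (A.filter fun y => ω ∈ openConn x y).card}
    · rw [Set.indicator_of_mem hω, Pi.one_apply, if_pos (by simpa only [Set.mem_setOf_eq] using hω)]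
    · rw [Set.indicator_of_notMem hω, if_neg (by simpa only [Set.mem_setOf_eq] using hω)]
  rw [e, integral_indicator_one MeasurableSet.of_discrete, measureReal_restrict_apply MeasurableSet.of_discrete]

/-- `E 1{j < |C(x) ∩ A|} = μ(j < |π(x)|)`. [folklore] -/
theorem integral_threshold (w : Sym2 (Fin n) → unitInterval) (A : Finset (Fin n)) (x : Fin n) (j : ℕ) :
    ∫ ω, (fun S : Set (Fin n) => if j < (A.filter fun y => y ∈ S).card then (1 : ℝ) else 0) (openCluster ω x)
        ∂(prodBernoulli w) =
      (prodBernoulli w).real {ω : BondConfig (Fin n) | j < (A.filter fun y => ω ∈ openConn x y).card} := by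
  rw [← setIntegral_univ, setIntegral_threshold, Set.inter_univ]

/-- `{o ↔ A} = {N ≥ 1}`: the observer meets the relay set iff its relay block is nonempty. [folklore] -/
theorem mem_iUnion_openConn_iff (A : Finset (Fin n)) (o : Fin n) (ω : BondConfig (Fin n)) :
    (ω ∈ ⋃ a' ∈ A, (openConn o a' : Set (BondConfig (Fin n)))) ↔
      1 ≤ (A.filter fun x => ω ∈ openConn o x).card := by
  rw [Nat.succ_le_iff, Finset.card_pos, Finset.filter_nonempty_iff, Set.mem_iUnion₂]
  constructor
  · rintro ⟨a, ha, h⟩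
    exact ⟨a, ha, h⟩
  · rintro ⟨a, ha, h⟩
    exact ⟨a, ha, h⟩

/-- **THE CUMULATIVE ISOLATION LEMMA, designated pre-FKG form — every level `j`, every relay set, every finite graph,
every weight vector in `[0,1]^E`.**  If `c ∈ A` maximises `P(|π(·)| ≤ j)` over `A`, then
`P(1 ≤ N ≤ j) ≤ P(o ↔ A, |π(c)| ≤ j)`, where `N = |C(o) ∩ A|`, `π(c) = C(c) ∩ A`.
Kozma–Nitzan's Conjecture 4 (tree theorem `Q7Psi.kn_conj4_designated`) for `F = 1{|· ∩ A| > j}`. [this work]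
[cite: KozmaNitzan2024, Conjecture 4 (p. 32), Lemma 2 (p. 6)] -/
theorem lowerTail_le_inter (w : Sym2 (Fin n) → unitInterval) (A : Finset (Fin n)) (o c : Fin n) (j : ℕ)
    (hcA : c ∈ A)
    (hcmax : ∀ a ∈ A,
      (prodBernoulli w).real {ω : BondConfig (Fin n) | (A.filter fun x => ω ∈ openConn a x).card ≤ j} ≤
        (prodBernoulli w).real {ω : BondConfig (Fin n) | (A.filter fun x => ω ∈ openConn c x).card ≤ j}) :
    (prodBernoulli w).real {ω : BondConfig (Fin n) |
        1 ≤ (A.filter fun x => ω ∈ openConn o x).card ∧ (A.filter fun x => ω ∈ openConn o x).card ≤ j} ≤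
      (prodBernoulli w).real ((⋃ a' ∈ A, (openConn o a' : Set (BondConfig (Fin n)))) ∩
        {ω : BondConfig (Fin n) | (A.filter fun x => ω ∈ openConn c x).card ≤ j}) := by
  set μ := prodBernoulli w with hμ
  haveI : IsProbabilityMeasure μ := by rw [hμ]; infer_instance
  have hmeas : ∀ S : Set (BondConfig (Fin n)), MeasurableSet S := fun _ => MeasurableSet.of_discrete
  -- notation: `T x = {j < |π(x)|}`, `E = {o ↔ A}`
  set T : Fin n → Set (BondConfig (Fin n)) := fun x =>
    {ω : BondConfig (Fin n) | j < (A.filter fun y => ω ∈ openConn x y).card} with hT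
  set E : Set (BondConfig (Fin n)) := ⋃ a' ∈ A, (openConn o a' : Set (BondConfig (Fin n))) with hE
  -- complements: `{|π(x)| ≤ j} = (T x)ᶜ`, so `μ(T x) = 1 - μ(|π(x)| ≤ j)`
  have hcompl : ∀ x : Fin n,
      {ω : BondConfig (Fin n) | (A.filter fun y => ω ∈ openConn x y).card ≤ j} = (T x)ᶜ := by
    intro x; ext ω
    simp only [hT, Set.mem_setOf_eq, Set.mem_compl_iff, not_lt]
  have hTreal : ∀ x : Fin n, μ.real (T x) =
      1 - μ.real {ω : BondConfig (Fin n) | (A.filter fun y => ω ∈ openConn x y).card ≤ j} := by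
    intro x
    rw [hcompl x, probReal_compl_eq_one_sub (hmeas _)]
    ring
  -- `c` is the least-mean relay for `F = 1{|· ∩ A| > j}`
  have hcmin : ∀ a ∈ A,
      ∫ ω, (fun S : Set (Fin n) => if j < (A.filter fun y => y ∈ S).card then (1 : ℝ) else 0) (openCluster ω c) ∂μ ≤
        ∫ ω, (fun S : Set (Fin n) => if j < (A.filter fun y => y ∈ S).card then (1 : ℝ) else 0) (openCluster ω a)
          ∂μ := by
    intro a ha
    rw [hμ, integral_threshold, integral_threshold, ← hμ]
    change μ.real (T c) ≤ μ.real (T a)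
    rw [hTreal, hTreal]
    linarith [hcmax a ha]
  -- Conjecture 4, designated form, for this `F`
  have h4 := Q7Psi.kn_conj4_designated w A o c
    (fun S : Set (Fin n) => if j < (A.filter fun y => y ∈ S).card then (1 : ℝ) else 0)
    (threshold_monotone A j) hcA hcmin
  rw [setIntegral_threshold, setIntegral_threshold] at h4
  -- `h4 : μ(T c ∩ E) ≤ μ(T o ∩ E)`
  change μ.real (T c ∩ E) ≤ μ.real (T o ∩ E) at h4
  -- bookkeeping: `{1 ≤ N ≤ j} = E \ T o`, `E ∩ {|π(c)| ≤ j} = E \ T c`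
  have hL : {ω : BondConfig (Fin n) |
      1 ≤ (A.filter fun x => ω ∈ openConn o x).card ∧ (A.filter fun x => ω ∈ openConn o x).card ≤ j} =
      E \ T o := by
    ext ω
    rw [Set.mem_sdiff, hE, mem_iUnion_openConn_iff A o ω]
    simp only [Set.mem_setOf_eq, hT, not_lt]
  have hR : E ∩ {ω : BondConfig (Fin n) | (A.filter fun x => ω ∈ openConn c x).card ≤ j} = E \ T c := by
    ext ω
    simp only [Set.mem_inter_iff, Set.mem_setOf_eq, Set.mem_sdiff, hT, not_lt]
  rw [hL, hR]
  have ho := measureReal_inter_add_sdiff (μ := μ) (s := E) (t := T o) (hmeas _) (measure_ne_top μ E)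
  have hc := measureReal_inter_add_sdiff (μ := μ) (s := E) (t := T c) (hmeas _) (measure_ne_top μ E)
  rw [Set.inter_comm] at ho hc
  linarith

/-- **THE CUMULATIVE ISOLATION LEMMA, every level** — existence form: for `A ≠ ∅` some relay `a ∈ A` has
`P(1 ≤ N ≤ j) ≤ P(|π(a)| ≤ j)` (take a maximiser of `P(|π(·)| ≤ j)` in `lowerTail_le_inter` and drop `{o ↔ A}`).
[this work] [cite: KozmaNitzan2024, Lemma 2 (p. 6), Conjecture 4 (p. 32)] -/
theorem exists_lowerTail_le (w : Sym2 (Fin n) → unitInterval) (A : Finset (Fin n)) (o : Fin n) (j : ℕ)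
    (hA : A.Nonempty) :
    ∃ a ∈ A, (prodBernoulli w).real {ω : BondConfig (Fin n) |
        1 ≤ (A.filter fun x => ω ∈ openConn o x).card ∧ (A.filter fun x => ω ∈ openConn o x).card ≤ j} ≤
      (prodBernoulli w).real {ω : BondConfig (Fin n) | (A.filter fun x => ω ∈ openConn a x).card ≤ j} := by
  obtain ⟨c, hcA, hcmax⟩ := Finset.exists_max_image A
    (fun a => (prodBernoulli w).real {ω : BondConfig (Fin n) | (A.filter fun x => ω ∈ openConn a x).card ≤ j}) hA
  refine ⟨c, hcA, (lowerTail_le_inter w A o c j hcA hcmax).trans ?_⟩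
  exact measureReal_mono Set.inter_subset_right

/-- **The registered stub `stub_cumulativeIsolation` of the one-cut line, verbatim** (all levels `j`; the hypothesis
`o ∉ A` is not needed). [this work] [cite: KozmaNitzan2024, Lemma 2 (p. 6), Conjecture 4 (p. 32)] -/
theorem stub_cumulativeIsolation :
    ∀ (n : ℕ) (w : Sym2 (Fin n) → unitInterval) (A : Finset (Fin n)) (o : Fin n) (j : ℕ),
      A.Nonempty → o ∉ A → ∃ a ∈ A,
        (Literature.Probability.LatticeModels.prodBernoulli w).real
            {ω : Literature.Probability.Percolation.BondConfig (Fin n) |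
              1 ≤ (A.filter fun x => ω ∈ Literature.Probability.Percolation.openConn o x).card ∧
                (A.filter fun x => ω ∈ Literature.Probability.Percolation.openConn o x).card ≤ j} ≤
          (Literature.Probability.LatticeModels.prodBernoulli w).real
            {ω : Literature.Probability.Percolation.BondConfig (Fin n) |
              (A.filter fun x => ω ∈ Literature.Probability.Percolation.openConn a x).card ≤ j} :=
  fun _ w A o j hA _ => exists_lowerTail_le w A o j hA

/-- **The registered stub `stub_attachedChampion` of the one-cut line, verbatim** — the ATTACHED-CHAMPION inequality
XZ: for every level-`j` champion `q ∈ A` (a maximiser of `P(|π(·)| ≤ j)` over `A`),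
`P(1 ≤ N ≤ j) ≤ P(|π(q)| ≤ j ∧ o ↔ A)` (the hypothesis `o ∉ A` is not needed). [this work]
[cite: KozmaNitzan2024, Conjecture 4 (p. 32)] -/
theorem stub_attachedChampion :
    ∀ (n : ℕ) (w : Sym2 (Fin n) → unitInterval) (A : Finset (Fin n)) (o q : Fin n) (j : ℕ), o ∉ A → q ∈ A →
      (∀ a ∈ A, (Literature.Probability.LatticeModels.prodBernoulli w).real
          {ω : Literature.Probability.Percolation.BondConfig (Fin n) |
            (A.filter fun x => ω ∈ Literature.Probability.Percolation.openConn a x).card ≤ j} ≤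
        (Literature.Probability.LatticeModels.prodBernoulli w).real
          {ω : Literature.Probability.Percolation.BondConfig (Fin n) |
            (A.filter fun x => ω ∈ Literature.Probability.Percolation.openConn q x).card ≤ j}) →
      (Literature.Probability.LatticeModels.prodBernoulli w).real
          {ω : Literature.Probability.Percolation.BondConfig (Fin n) |
            1 ≤ (A.filter fun x => ω ∈ Literature.Probability.Percolation.openConn o x).card ∧
              (A.filter fun x => ω ∈ Literature.Probability.Percolation.openConn o x).card ≤ j} ≤
        (Literature.Probability.LatticeModels.prodBernoulli w).real
          {ω : Literature.Probability.Percolation.BondConfig (Fin n) |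
            (A.filter fun x => ω ∈ Literature.Probability.Percolation.openConn q x).card ≤ j ∧
              1 ≤ (A.filter fun x => ω ∈ Literature.Probability.Percolation.openConn o x).card} := by
  intro n w A o q j _ hqA hqmax
  have h := lowerTail_le_inter w A o q j hqA hqmax
  have e : ((⋃ a' ∈ A, (openConn o a' : Set (BondConfig (Fin n)))) ∩
        {ω : BondConfig (Fin n) | (A.filter fun x => ω ∈ openConn q x).card ≤ j}) =
      {ω : BondConfig (Fin n) | (A.filter fun x => ω ∈ openConn q x).card ≤ j ∧
        1 ≤ (A.filter fun x => ω ∈ openConn o x).card} := by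
    ext ω
    rw [Set.mem_inter_iff, mem_iUnion_openConn_iff A o ω, Set.mem_setOf_eq, Set.mem_setOf_eq]
    exact And.comm
  rw [e] at h
  exact h

/-- **Second derivation of the crux `NoHeavyLowerTail` (stmt-CriticalPhenomena-4575)** through the one-cut line:
CIL (this file) fed to the landed reduction `Theorems.noHeavyLowerTail_of_stub_cumulativeIsolation` (pair counting +
`noHeavyLowerTail_of_fatMinorityLinear`), stated for the route `PercNearOneGluingNoHeavy` decl (definitionally the
`PercNearOneGluing` one the reduction concludes). [this work] [cite: KozmaNitzan2024, Conjecture 3 (p. 15)] -/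
theorem noHeavyLowerTail_of_cil :
    Summit.CriticalPhenomena.PercolationContinuityZ3.Theses.PercNearOneGluingNoHeavy.NoHeavyLowerTail :=
  noHeavyLowerTail_of_stub_cumulativeIsolation stub_cumulativeIsolation

end CIL

end Summit.CriticalPhenomena.PercolationContinuityZ3.Theorems

end
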